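/-
Copyright (c) 2026 the pub-hodgecm-mathlib formalisation cell (harness21).  Prover seat hodgecm-mathlib-K2E5-p17 (g3) (free E5 hand on the E3 road),
Track B «K2-LIT» ∕ h413 (`stmt-HodgeConjecture-24833`), line `K2_E3_EllipticInputs`, unit U12-d, §L (Φ′-b): transport of Haar measure and of the Lie-algebra
Fourier transform along ★ (Φ′-a) `Φ : 𝔲(σ, J₀) ≃+ 𝔤𝔩₂(F)`.  2026-09-04.
-/
import Summits.HodgeConjecture.HodgeConjecture.Theorems.K2E3U11LieTransport    -- ★ p857144 (Φ′-a) (K2E3-p12 (g4)): `exists_lieTransport`, `lieTransport_trace`; ★ `lieOfForm`, `lieFourier`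
import Mathlib.MeasureTheory.Measure.Haar.Unique
import HarnessLib

/-!
# K2_E3 road (h413), §L — (Φ′-b) `K2E3U11LieTransportFourier`: Haar measure and Fourier transform along `Φ : 𝔲(σ, J₀) ≃ 𝔤𝔩₂(F)`

Cell `pub/hodgecm-mathlib` (D-0151), Track B, seat K2E5-p17 (g3); DEAL BY NAME §L lead K2E3-p12 (g4) 2026-09-04T03:51Z (MEMO v3 `K2/K2E3-p12/g4/MEMO-SL-LieCores-line.v3…`
road «U-iso-T»: the last plumbing brick before the (L-B_U)′ :373 @ `N = 2` ISOTROPIC reduction «⟸ reg(ν̂₊), reg(ν̂₋) on `𝔤𝔩₂(L⁺_v)`»).  `--supports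
stmt-HodgeConjecture-24833 --as helper`; THEOREMS ONLY (no definition ∕ instance ∕ notation ∕ named fact ∕ `sorry`); never imports `Cruxes/…/Lines`.  COUNT-NEUTRAL.

FRAME = ★ p857144 `K2E3U11LieTransport` §2∕§3 VERBATIM: fields `F`, `E` (topological for the measure-theoretic statements), `ι : F →+* E`, `σ : E →+* E` with
`σ ∘ ι = ι`, `σ λ = −λ`, `λ² = ι d`, coordinates `ρ = (re, im)`, `(2 : E) ≠ 0`; `J₀ = !![0,1;1,0]`; and `Φ : ↥(lieOfForm σ J₀) ≃+ Matrix (Fin 2) (Fin 2) F` ANY additive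
equivalence with the formula of ★ `exists_lieTransport` (`hΦ`), bi-continuous (`hΦc`, `hΦs`) where measures are moved.
* §1 **`isAddHaarMeasure_map_lieTransport`** — `Φ_* μ` is an additive Haar measure on `𝔤𝔩₂(F)` for every additive Haar measure `μ` on `𝔲(σ, J₀)`
  (Mathlib `AddEquiv.isAddHaarMeasure_map`); `integral_comp_lieTransport` — `∫ g(Φ X) dμ(X) = ∫ g dΦ_*μ` for EVERY `g` (`MeasureTheory.integral_map_equiv` on the
  measurable equivalence underlying the homeomorphism `Φ`; no measurability hypothesis); `integral_comp_lieTransport_symm` — `∫ h dμ = ∫ h(Φ⁻¹ X′) dΦ_*μ(X′)`.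
* §2 the trace form through `Φ`: `trace_smul_one_add_mul` and **`trace_mul_eq_lieTransport`** — `tr(Y·X) = ι( tr( S(ΦY) · ΦX ) )` with the CENTRAL TWIST
  `S M := M + ((d−1)∕2 · tr M) • 1` (★ `lieTransport_trace` «`2 tr(XY) = ι(2 tr(ΦXΦY) + (d−1) trΦX trΦY)`» divided by `2`).
* §3 **`lieFourier_eq_integral_map`** — the Lie-algebra Fourier transform ★ `lieFourier σ J₀ ψ μ f Y = ∫ ψ(tr(Y X)) f(X) dμ` READ ON `𝔤𝔩₂(F)`:
  `= ∫ X′, ψ(ι(tr(S(ΦY) · X′))) · f(Φ⁻¹ X′) dΦ_*μ(X′)` — i.e. up to the central twist `S` and the embedding `ι` of the phase, `(𝓕_𝔲 f) ∘ Φ⁻¹` is the `𝔤𝔩₂(F)`-Fourier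
  transform of `f ∘ Φ⁻¹` for the transported Haar measure (on functions supported in the nilpotent cone `S` is invisible: `tr = 0` there).
[PlatonovRapinchuk1994, §2.3] [Knapp2002, I §8] [HarishChandra1999AdmissibleDistributions, §4 p. 11 (the pairing `B(X,Y) = tr(XY)` and `f̂`)] [Folland1995, §2.2 Thm. 2.20].
HONEST LABEL: HC_CM is proved only modulo the 7 printed citations (2 remaining named inputs: hLiu418 = stmt-HodgeConjecture-24832, h413 = stmt-HodgeConjecture-24833)
until rung 0 closes; count-neutral plumbing.
-/

set_option autoImplicit false
set_option linter.dupNamespace false   -- `Summit.HodgeConjecture.HodgeConjecture.…` (D-0017 nested layout; lakefile exemption for Summits)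

noncomputable section

open MeasureTheory Measure
open scoped Matrix MatrixGroups
open Literature.NumberTheory.Automorphic
open Summit.HodgeConjecture.HodgeConjecture.Cruxes.H413.K2E3LieUnitary (lieOfForm mem_lieOfForm_iff lieFourier lieFourier_apply)
open Summit.HodgeConjecture.HodgeConjecture.Cruxes.H413.K2E3U11LieTransport

namespace Summit.HodgeConjecture.HodgeConjecture.Cruxes.H413.K2E3U11LieTransportFourier

/-! ## §1  Haar measure and integrals through `Φ` -/

section Measure

variable {F E : Type*} [Field F] [Field E] [TopologicalSpace F] [TopologicalSpace E] [IsTopologicalRing F] [IsTopologicalRing E]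
  (σ : E →+* E)
  [MeasurableSpace ↥(lieOfForm σ !![(0 : E), 1; 1, 0])] [BorelSpace ↥(lieOfForm σ !![(0 : E), 1; 1, 0])]
  [MeasurableSpace (Matrix (Fin 2) (Fin 2) F)] [BorelSpace (Matrix (Fin 2) (Fin 2) F)]
  (Φ : ↥(lieOfForm σ !![(0 : E), 1; 1, 0]) ≃+ Matrix (Fin 2) (Fin 2) F) (hΦc : Continuous Φ) (hΦs : Continuous Φ.symm)

include hΦc hΦs in
/-- **`Φ_* μ` is an additive Haar measure on `𝔤𝔩₂(F)`** for an additive Haar measure `μ` on `𝔲(σ, J₀)` (a bi-continuous additive isomorphism transports Haar measures).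
[cite: Folland1995, §2.2 Thm. 2.20] [cite: PlatonovRapinchuk1994, §2.3] -/
theorem isAddHaarMeasure_map_lieTransport [T2Space F] (μ : Measure ↥(lieOfForm σ !![(0 : E), 1; 1, 0])) [μ.IsAddHaarMeasure] :
    (μ.map Φ).IsAddHaarMeasure := by
  haveI : T2Space (Matrix (Fin 2) (Fin 2) F) := inferInstanceAs (T2Space (Fin 2 → Fin 2 → F))
  haveI : IsTopologicalAddGroup (Matrix (Fin 2) (Fin 2) F) := inferInstanceAs (IsTopologicalAddGroup (Fin 2 → Fin 2 → F))
  exact AddEquiv.isAddHaarMeasure_map μ Φ hΦc hΦs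

omit [IsTopologicalRing F] [IsTopologicalRing E] in
include hΦc hΦs in
/-- **Change of variables `X′ = Φ X`**: `∫ g(Φ X) dμ(X) = ∫ g(X′) dΦ_*μ(X′)` for EVERY `g` (no measurability needed: `Φ` underlies a measurable equivalence).
[cite: Folland1995, §2.2 Thm. 2.20] -/
theorem integral_comp_lieTransport {G : Type*} [NormedAddCommGroup G] [NormedSpace ℝ G] (μ : Measure ↥(lieOfForm σ !![(0 : E), 1; 1, 0]))
    (g : Matrix (Fin 2) (Fin 2) F → G) : ∫ X, g (Φ X) ∂μ = ∫ X', g X' ∂(μ.map Φ) := by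
  let eH : ↥(lieOfForm σ !![(0 : E), 1; 1, 0]) ≃ₜ Matrix (Fin 2) (Fin 2) F :=
    { toEquiv := Φ.toEquiv, continuous_toFun := hΦc, continuous_invFun := hΦs }
  have he : (eH.toMeasurableEquiv : ↥(lieOfForm σ !![(0 : E), 1; 1, 0]) → Matrix (Fin 2) (Fin 2) F) = Φ := rfl
  rw [← he, integral_map_equiv]

omit [IsTopologicalRing F] [IsTopologicalRing E] in
include hΦc hΦs in
/-- The same read backwards through `Φ⁻¹`: `∫ h dμ = ∫ h(Φ⁻¹ X′) dΦ_*μ(X′)`. [cite: Folland1995, §2.2 Thm. 2.20] -/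
theorem integral_comp_lieTransport_symm {G : Type*} [NormedAddCommGroup G] [NormedSpace ℝ G] (μ : Measure ↥(lieOfForm σ !![(0 : E), 1; 1, 0]))
    (h : ↥(lieOfForm σ !![(0 : E), 1; 1, 0]) → G) : ∫ X, h X ∂μ = ∫ X', h (Φ.symm X') ∂(μ.map Φ) := by
  rw [← integral_comp_lieTransport σ Φ hΦc hΦs μ (fun X' => h (Φ.symm X'))]
  simp only [AddEquiv.symm_apply_apply]

end Measure

/-! ## §2  The trace form through `Φ`: `tr(Y·X) = ι(tr(S(ΦY)·ΦX))`, `S M = M + ((d−1)∕2 · tr M)·1` -/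

section Trace

variable {F E : Type*} [Field F] [Field E] (σ : E →+* E) (ι : F →+* E) (lam : E) (ρ : E → F × F)
  (hρ1 : ∀ z, ι (ρ z).1 + lam * ι (ρ z).2 = z) (hρ2 : ∀ r i, ρ (ι r + lam * ι i) = (r, i))
  (hσι : ∀ r, σ (ι r) = ι r) (hσl : σ lam = -lam) (h2 : (2 : E) ≠ 0) (d : F) (hd : lam * lam = ι d)
  (Φ : ↥(lieOfForm σ !![(0 : E), 1; 1, 0]) ≃+ Matrix (Fin 2) (Fin 2) F)
  (hΦ : ∀ X : ↥(lieOfForm σ !![(0 : E), 1; 1, 0]),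
    Φ X = !![(ρ (X.1 0 0)).1 + (ρ (X.1 0 0)).2, d * (ρ (X.1 0 1)).2; (ρ (X.1 1 0)).2, (ρ (X.1 0 0)).2 - (ρ (X.1 0 0)).1])

omit [Field E] in
/-- `tr((A + c·1)·B) = tr(A·B) + c·tr B`. [folklore] -/
theorem trace_add_smul_one_mul (A B : Matrix (Fin 2) (Fin 2) F) (c : F) :
    Matrix.trace ((A + c • (1 : Matrix (Fin 2) (Fin 2) F)) * B) = Matrix.trace (A * B) + c * Matrix.trace B := by
  rw [Matrix.add_mul, Matrix.trace_add, Matrix.smul_mul, Matrix.one_mul, Matrix.trace_smul, smul_eq_mul]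

include hρ1 hσι hσl h2 hd hΦ in
/-- **The trace pairing through `Φ`**: `tr(Y·X) = ι( tr( (ΦY + ((d−1)∕2 · tr ΦY)·1) · ΦX ) )` for `X, Y ∈ 𝔲(σ, J₀)` — ★ `lieTransport_trace` divided by `2`; the twist
`S M = M + ((d−1)∕2 · tr M)·1` is central, so it vanishes against traceless (e.g. nilpotent) arguments. [cite: HarishChandra1999AdmissibleDistributions, §4 p. 11]
[cite: PlatonovRapinchuk1994, §2.3] -/
theorem trace_mul_eq_lieTransport (X Y : ↥(lieOfForm σ !![(0 : E), 1; 1, 0])) :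
    Matrix.trace (Y.1 * X.1) = ι (Matrix.trace ((Φ Y + (((d - 1) / 2) * Matrix.trace (Φ Y)) • (1 : Matrix (Fin 2) (Fin 2) F)) * Φ X)) := by
  have h2F : (2 : F) ≠ 0 := fun h => h2 (by rw [← map_ofNat ι 2, h, map_zero])
  have key := lieTransport_trace σ ι lam ρ hρ1 hσι hσl h2 d hd Φ hΦ Y X
  refine mul_left_cancel₀ h2 ?_
  rw [key, trace_add_smul_one_mul, ← map_ofNat ι 2, ← map_mul ι]
  congr 1
  field_simp

end Trace

/-! ## §3  The Fourier transform on `𝔲(σ, J₀)` read on `𝔤𝔩₂(F)` -/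

section Fourier

variable {F E : Type*} [Field F] [Field E] [TopologicalSpace F] [TopologicalSpace E]
  (σ : E →+* E) (ι : F →+* E) (lam : E) (ρ : E → F × F)
  (hρ1 : ∀ z, ι (ρ z).1 + lam * ι (ρ z).2 = z) (hρ2 : ∀ r i, ρ (ι r + lam * ι i) = (r, i))
  (hσι : ∀ r, σ (ι r) = ι r) (hσl : σ lam = -lam) (h2 : (2 : E) ≠ 0) (d : F) (hd : lam * lam = ι d)
  [MeasurableSpace ↥(lieOfForm σ !![(0 : E), 1; 1, 0])] [BorelSpace ↥(lieOfForm σ !![(0 : E), 1; 1, 0])]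
  [MeasurableSpace (Matrix (Fin 2) (Fin 2) F)] [BorelSpace (Matrix (Fin 2) (Fin 2) F)]
  (Φ : ↥(lieOfForm σ !![(0 : E), 1; 1, 0]) ≃+ Matrix (Fin 2) (Fin 2) F) (hΦc : Continuous Φ) (hΦs : Continuous Φ.symm)
  (hΦ : ∀ X : ↥(lieOfForm σ !![(0 : E), 1; 1, 0]),
    Φ X = !![(ρ (X.1 0 0)).1 + (ρ (X.1 0 0)).2, d * (ρ (X.1 0 1)).2; (ρ (X.1 1 0)).2, (ρ (X.1 0 0)).2 - (ρ (X.1 0 0)).1])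

include hρ1 hσι hσl h2 hd hΦc hΦs hΦ in
/-- **THE LIE-ALGEBRA FOURIER TRANSFORM ALONG `Φ`**: for every `ψ : E → ℂ`, measure `μ` on `𝔲(σ, J₀)`, `f` and `Y`,
`lieFourier σ J₀ ψ μ f Y = ∫ X′, ψ(ι(tr((ΦY + ((d−1)∕2 · tr ΦY)·1) · X′))) · f(Φ⁻¹ X′) dΦ_*μ(X′)` — change of variables `X = Φ⁻¹ X′` (★ §1) and the trace pairing
★ `trace_mul_eq_lieTransport`.  With `μ` Haar, `Φ_*μ` is Haar on `𝔤𝔩₂(F)` (★ `isAddHaarMeasure_map_lieTransport`), so up to the central twist and `ι` this is the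
`𝔤𝔩₂(F)`-Fourier transform `∫ ψ_F(tr(Y′X′)) (f ∘ Φ⁻¹)(X′) dX′` of ★ p856457's currency. [cite: HarishChandra1999AdmissibleDistributions, §4 p. 11] [cite: PlatonovRapinchuk1994, §2.3] -/
theorem lieFourier_eq_integral_map (ψ : E → ℂ) (μ : Measure ↥(lieOfForm σ !![(0 : E), 1; 1, 0])) (f : ↥(lieOfForm σ !![(0 : E), 1; 1, 0]) → ℂ)
    (Y : ↥(lieOfForm σ !![(0 : E), 1; 1, 0])) :
    lieFourier σ !![(0 : E), 1; 1, 0] ψ μ f Y =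
      ∫ X', ψ (ι (Matrix.trace ((Φ Y + (((d - 1) / 2) * Matrix.trace (Φ Y)) • (1 : Matrix (Fin 2) (Fin 2) F)) * X'))) * f (Φ.symm X') ∂(μ.map Φ) := by
  rw [lieFourier_apply, ← integral_comp_lieTransport σ Φ hΦc hΦs μ]
  refine integral_congr_ae (Filter.Eventually.of_forall fun X => ?_)
  simp only [AddEquiv.symm_apply_apply]
  rw [trace_mul_eq_lieTransport σ ι lam ρ hρ1 hσι hσl h2 d hd Φ hΦ X Y]

include hρ1 hσι hσl h2 hd hΦc hΦs hΦ in
/-- The same with the phase written through the transported variable only: for `Y′ := Φ Y`,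
`(lieFourier σ J₀ ψ μ f) (Φ⁻¹ Y′) = ∫ X′, ψ(ι(tr((Y′ + ((d−1)∕2 · tr Y′)·1) · X′))) · f(Φ⁻¹ X′) dΦ_*μ(X′)`. [cite: HarishChandra1999AdmissibleDistributions, §4 p. 11] -/
theorem lieFourier_symm_eq_integral_map (ψ : E → ℂ) (μ : Measure ↥(lieOfForm σ !![(0 : E), 1; 1, 0])) (f : ↥(lieOfForm σ !![(0 : E), 1; 1, 0]) → ℂ)
    (Y' : Matrix (Fin 2) (Fin 2) F) :
    lieFourier σ !![(0 : E), 1; 1, 0] ψ μ f (Φ.symm Y') =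
      ∫ X', ψ (ι (Matrix.trace ((Y' + (((d - 1) / 2) * Matrix.trace Y') • (1 : Matrix (Fin 2) (Fin 2) F)) * X'))) * f (Φ.symm X') ∂(μ.map Φ) := by
  rw [lieFourier_eq_integral_map σ ι lam ρ hρ1 hσι hσl h2 d hd Φ hΦc hΦs hΦ, AddEquiv.apply_symm_apply]

end Fourier

end Summit.HodgeConjecture.HodgeConjecture.Cruxes.H413.K2E3U11LieTransportFourier

end
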